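import Mathlib
import Summits.Ventures.HodgeRepro2.T5SmoothIsotypic
import Summits.Ventures.HodgeRepro2.T6N5LocalDatum
import Summits.Ventures.HodgeRepro2.T6N5LocalHyp
import Summits.Ventures.HodgeRepro2.T6N5Local

/-!
# T6N5LocalWeil — Tier 6, M2 sub-step N5 (t6-p8's half): the binder (A1) of `N5Local_main` discharged from a
carried Weil representation

TIER5 §N5.11.3 uses, at the place `v`, that the Weil representation `ω_{V_s,W,ι̃,ψ}` of `U(V_s) × U(W)` restricted
to the compact abelian group `U(V_s) = E¹_v` is a non-zero smooth representation, hence has a non-zero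
`α`-isotypic component for some character `α` of `E¹_v` — the standard fact (A1) that `N5Local_main` takes as the
binder `hA1`. Here the Weil representation is CARRIED (data: `WeilLocalDatum`), the theta predicate of the local
sign datum is DEFINED from it (`Θ_{V_s,W,ι̃,ψ}(α ∘ i′_V) ≠ 0` ⟺ the `α`-isotypic component of the Weil
representation of the line `V_s` is non-zero — for a compact group the maximal `α`-isotypic quotient is the
isotypic component, TIER5 (A1)), and (A1) is PROVED from p4's accepted `T5SmoothIsotypic` (the spanning half of the
smooth isotypic decomposition: a vector fixed by a finite-index subgroup lies in the sum of the isotypic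
components) given the datum's non-vanishing and smoothness. `N5Local_main_of_weil` is `N5Local_main` with `hA1`
discharged.
README §8(d): uses an L-value-free non-vanishing device: NO.
-/

namespace Summit.Ventures.HodgeRepro2.T6.N5LocalWeil

open Summit.Ventures.HodgeRepro2.T6.N5LocalDatum Summit.Ventures.HodgeRepro2.T6.N5Local
  Summit.Ventures.HodgeRepro2.T6.Hyp Summit.Ventures.HodgeRepro2.T5SmoothIsotypic

/-- The local sign datum together with the Weil representations of the two hermitian lines (data only):
`A` = the compact abelian group `U(V) = E¹_v` written additively (its characters `AddChar A ℂ` are Borade's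
`α : K¹ → ℂ^×`), `Wsp s` / `ωWeil s` = the space and the action of `ω_{V_s,W,ι̃,ψ}` restricted to `U(V_s)` for the
hermitian line `V_s` with `ϵ(V_s) = s`, `ofOne α` = `α_K = α ∘ j` (the character of `E_v^×` obtained through
`j : E_v^× → E¹_v`, `x ↦ x/x̄`; Borade §3.3.1 «α_K»). -/
structure WeilLocalDatum where
  /-- the underlying local sign datum (characters of `E_v^×`, root numbers, `χ_W`, `ϵ_δ(W)`, the line symbols) —
  its `Theta` field is NOT used (it is replaced by `thetaOf` below). -/
  base : LocalSignDatum
  /-- `U(V) = E¹_v` as an additive abelian group. -/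
  A : Type
  [instA : AddCommGroup A]
  /-- the space of the Weil representation of the line `V_s` (restricted to `U(V_s)`), `s = ϵ(V_s)`. -/
  Wsp : ℤˣ → Type
  [instW : ∀ s, AddCommGroup (Wsp s)]
  [instWm : ∀ s, Module ℂ (Wsp s)]
  /-- the Weil representation `ω_{V_s,W,ι̃,ψ}` restricted to `U(V_s) = E¹_v` (TIER5 (A1): the Schrödinger model). -/
  ωWeil : ∀ s, Representation ℂ (Multiplicative A) (Wsp s)
  /-- `α ↦ α_K = α ∘ j`: the character of `E_v^×` attached to a character `α` of `E¹_v`. -/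
  ofOne : AddChar A ℂ → base.Char

attribute [instance] WeilLocalDatum.instA WeilLocalDatum.instW WeilLocalDatum.instWm

namespace WeilLocalDatum

variable (W : WeilLocalDatum)

/-- «Θ_{V_s,W,ι̃,ψ}(α ∘ i′_V) is non-zero», DEFINED: the `α`-isotypic component of the Weil representation of the
line `V_s` is non-zero (for the compact group `U(V_s)` the maximal `α`-isotypic quotient of `ω` is its `α`-isotypic
component — TIER5 §N5.11.3 (A1)); stated for the character `ξ = α_K` of `E_v^×`. -/
def thetaOf (s : ℤˣ) (ξ : W.base.Char) : Prop :=
  ∃ α : AddChar W.A ℂ, W.ofOne α = ξ ∧ isotypic (W.ωWeil s) α ≠ ⊥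

/-- The local sign datum with the theta predicate defined from the carried Weil representation. -/
def toLocalSignDatum : LocalSignDatum := { W.base with Theta := W.thetaOf }

/-- Smoothness of the Weil representation restricted to the compact group: every vector is fixed by a subgroup of
finite index (an open subgroup of a compact group). -/
def IsSmoothCompact (s : ℤˣ) : Prop :=
  ∀ v : W.Wsp s, ∃ K : AddSubgroup W.A, Nonempty (Fintype (W.A ⧸ K)) ∧ v ∈ fixedBy (W.ωWeil s) K

/-- A non-zero smooth representation of the compact abelian group has a non-zero isotypic component
(the spanning half of the smooth isotypic decomposition, p4's `T5SmoothIsotypic.mem_iSup_isotypic_of_mem_fixedBy`). -/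
theorem exists_isotypic_ne_bot (s : ℤˣ) (hsm : W.IsSmoothCompact s) [Nontrivial (W.Wsp s)] :
    ∃ α : AddChar W.A ℂ, isotypic (W.ωWeil s) α ≠ ⊥ := by
  classical
  obtain ⟨v, hv⟩ := exists_ne (0 : W.Wsp s)
  obtain ⟨K, ⟨hK⟩, hvK⟩ := hsm v
  have hmem := mem_iSup_isotypic_of_mem_fixedBy (W.ωWeil s) K hvK
  by_contra hall
  have hall' : ∀ α, isotypic (W.ωWeil s) α = ⊥ := fun α => by
    by_contra h
    exact hall ⟨α, h⟩
  have hbot : (⨆ α, isotypic (W.ωWeil s) α) = ⊥ := by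
    simp only [hall', iSup_bot]
  rw [hbot, Submodule.mem_bot] at hmem
  exact hv hmem

/-- (A1) for the built datum: for each sign `s` some conjugate-orthogonal `α_K` occurs in the Weil representation of
`V_s` — from non-vanishing, smoothness, and `j(F_v^×) = 1` (`hofOne`: every `α_K` is conjugate-orthogonal). -/
theorem hA1_of_weil (hsm : ∀ s, W.IsSmoothCompact s) [hnt : ∀ s, Nontrivial (W.Wsp s)]
    (hofOne : ∀ α, W.toLocalSignDatum.IsCO (W.ofOne α)) :
    ∀ s : ℤˣ, ∃ ξ : W.toLocalSignDatum.Char, W.toLocalSignDatum.IsCO ξ ∧ W.toLocalSignDatum.Theta s ξ := by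
  intro s
  obtain ⟨α, hα⟩ := W.exists_isotypic_ne_bot s (hsm s)
  exact ⟨W.ofOne α, hofOne α, α, rfl, hα⟩

/-- THEOREM N5.T2 (`N5Local_main`) with the binder (A1) discharged from the carried Weil representation. -/
theorem N5Local_main_of_weil (h35 : BFGYYZ2025_Thm3_5 W.toLocalSignDatum)
    (hsm : ∀ s, W.IsSmoothCompact s) [∀ s, Nontrivial (W.Wsp s)]
    (hofOne : ∀ α, W.toLocalSignDatum.IsCO (W.ofOne α))
    (hW : W.toLocalSignDatum.epsdW = 1) (hη : W.toLocalSignDatum.η * W.toLocalSignDatum.η = 1)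
    (hχW : W.toLocalSignDatum.IsCS W.toLocalSignDatum.χW)
    (hiii : W.toLocalSignDatum.ηu = -1 → W.toLocalSignDatum.ηLine 0 = W.toLocalSignDatum.ηLine 1 →
      ∃ a c : W.toLocalSignDatum.Char, W.toLocalSignDatum.IsCS a ∧ W.toLocalSignDatum.IsCS c ∧
        W.toLocalSignDatum.eps a = W.toLocalSignDatum.ηLine 0 ∧
        W.toLocalSignDatum.eps c = -W.toLocalSignDatum.ηLine 0 ∧
        W.toLocalSignDatum.eps (c⁻¹ * a * a) = -W.toLocalSignDatum.ηLine 0) :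
    ∃ ξ : Fin 4 → W.toLocalSignDatum.Char, LocalSolution W.toLocalSignDatum ξ :=
  N5Local_main W.toLocalSignDatum h35 (W.hA1_of_weil hsm hofOne) hW hη hχW hiii

end WeilLocalDatum

end Summit.Ventures.HodgeRepro2.T6.N5LocalWeil
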